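import Mathlib.Analysis.SpecificLimits.Normed
import Mathlib.Analysis.Asymptotics.SpecificAsymptotics
import Mathlib.Analysis.SpecialFunctions.Pow.Real
import Literature.Computability.AlgebraicComplexity.SkewCoppersmithWinogradProofs
import Literature.Computability.AlgebraicComplexity.BorderRankSkewCW
import Literature.Computability.AlgebraicComplexity.BorderRankCWDischarge
import Literature.Computability.AlgebraicComplexity.BorderRankKronecker
import Literature.Computability.AlgebraicComplexity.AsymptoticRankZariskiClosedProofs
import HarnessLib

/-!
# The laser-method bound for the skew little Coppersmith–Winograd tensor, border-rank form — proved
(discharge of `CGLV2022_skewCw_borderRank_form`)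

Topic `Literature/Computability/AlgebraicComplexity`; sequel of `SkewCoppersmithWinogradProofs.lean`,
which proved the asymptotic-rank form `CGLV2022_skewCw_asymptoticRank_form_holds` and the rank form
and left the VERBATIM statement of Conner–Gesmundo–Landsberg–Ventura 2022, §2.2 (arXiv Thm. 2.5),

  "**Theorem 2.5.** For all `k`, `ω ≤ log_q((4/27) (bR(T_{skewcw,q}^{⊠k}))^{3/k})`",

i.e. the named fact `CGLV2022_skewCw_borderRank_form` of `SkewCoppersmithWinograd.lean`, undischarged
("compose with `R̃ ≤ bR`; left to a sequel").  This file is that sequel.  The composition is the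
remark of Bürgisser–Clausen–Shokrollahi 1997, Lemma (15.27) / Ex. 15.24(2) (`R̃(t) ≤ bR(t)`: a
border-rank bound on ONE Kronecker power controls the growth of the ranks of ALL powers up to a
polynomial factor, Bläser 2013 Thm. 6.6) fed into the asymptotic-rank form:

* `tensorRank_kroneckerPow_le_of_algBorderRank_pow` — for every non-zero tensor `t` over `ℂ` and
  `k ≥ 1`, with `b = bR(t^{⊠k})` and `ρ = b^{1/k}`: `R(t^{⊠N}) ≤ C · (N+1)² · ρ^N` for all `N`
  (`N = k⌊N/k⌋ + (N mod k)`; `R(t^{⊠ km}) ≤ R((t^{⊠k})^{⊠m}) ≤ C(mh+2,2) b^m` at an order `h` with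
  `bR = R_h`, tree `tensorRank_kroneckerPow_le_of_approxRank_le`; sub-multiplicativity for the
  remainder).
* `isBigO_tensorRank_kroneckerPow_of_algBorderRank_pow` — hence, when `b ≥ 2` (so `ρ > 1` absorbs
  the polynomial factor), `R(t^{⊠N}) = O(ρ^{(1+ε)N})` for every `ε > 0`: the growth hypothesis of the
  asymptotic-rank forms of the tree.
* `algBorderRank_le_algBorderRank_kroneckerPow` — `bR(t) ≤ bR(t^{⊠k})` for `k ≥ 1` when some entry
  of `t` equals `1` (restriction to a coordinate slice), whence `bR(T_{skewcw,q}^{⊠k}) ≥ q + 3 ≥ 5`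
  by the tree's `add_three_le_algBorderRank_skewCwTensor` (CGLV Prop. 3.1 direction `≥`, Koszul
  flattening).
* `CGLV2022_skewCw_borderRank_form_holds` — **the DISCHARGE**: Thm. 2.5 verbatim, for every even
  `q = 2u ≥ 2` and `k ≥ 1`.
* `CGLV2022_thm11_cw_borderRank_form` — the same composition for the little Coppersmith–Winograd
  tensor itself: **CGLV Thm. 1.1 (= Coppersmith–Winograd 1990, BCS Ex. 15.24) verbatim,
  `ω ≤ log_q((4/27) bR(T_{cw,q}^{⊠k})^{3/k})` for `q ≥ 2`, `k ≥ 1`**, proved from the tree's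
  `CoppersmithWinograd1990_asymptoticRank_form_holds` (the rank and asymptotic-rank forms were the
  only ones vendored in `CoppersmithWinograd1990.lean`).

Everything is proved; no definitions, no named facts.

## References

* A. Conner, F. Gesmundo, J. M. Landsberg, E. Ventura, *Rank and border rank of Kronecker powers of
  tensors and Strassen's laser method*, comput. complexity 31 (2022) = arXiv:1909.04785, Thm. 1.1,
  §2.2 Thm. 2.5, §1.1 (sub-multiplicativity). [ConnerGesmundoLandsbergVentura2022]
* P. Bürgisser, M. Clausen, M. A. Shokrollahi, *Algebraic Complexity Theory* (1997), Lemma (15.27),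
  Ex. 15.24(2),(7). [BurgisserClausenShokrollahi1997]
* M. Bläser, *Fast Matrix Multiplication*, ToC Graduate Surveys 5 (2013), Thm. 6.3(3), Thm. 6.6.
  [Blaser2013]
-/

noncomputable section

open scoped BigOperators
open Filter Asymptotics Finset

namespace Literature.Computability.AlgebraicComplexity

/-! ## Growth of the ranks of all Kronecker powers from the border rank of one power -/

section Growth

variable {ι κ μ : Type} [Fintype ι] [Fintype κ] [Fintype μ] [DecidableEq ι] [DecidableEq κ]
  [DecidableEq μ]

/-- **`R(t^{⊠N}) ≤ C (N+1)² bR(t^{⊠k})^{N/k}`** for a non-zero tensor `t` over `ℂ` and `k ≥ 1`: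
with `b = bR(t^{⊠k}) = R_h(t^{⊠k})`, `ρ = b^{1/k}` and `M = max(1, R(t^{⊠1}))`,
`R(t^{⊠N}) ≤ R((t^{⊠k})^{⊠⌊N/k⌋}) · R(t^{⊠(N mod k)}) ≤ C(⌊N/k⌋h+2, 2) b^{⌊N/k⌋} · M^k
≤ M^k (h+2)² (N+1)² ρ^N` (Bläser 2013, Thm. 6.3(3)/6.6 via the tree's
`tensorRank_kroneckerPow_le_of_approxRank_le`; BCS 1997, Lemma (15.27)).
[cite: BurgisserClausenShokrollahi1997, Lemma (15.27)] -/
theorem tensorRank_kroneckerPow_le_of_algBorderRank_pow (t : ι → κ → μ → ℂ) (ht : t ≠ 0) (k : ℕ)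
    (hk : 1 ≤ k) :
    ∃ C : ℝ, 0 < C ∧ ∀ N : ℕ, (tensorRank (kroneckerPow t N) : ℝ) ≤
      C * ((N : ℝ) + 1) ^ 2 *
        (((algBorderRank (kroneckerPow t k) : ℕ) : ℝ) ^ ((k : ℝ)⁻¹)) ^ N := by
  set S := kroneckerPow t k with hS
  set b : ℕ := algBorderRank S with hb
  obtain ⟨h, hh⟩ := exists_algBorderRank_eq_approxRank S
  set M : ℕ := max 1 (tensorRank (kroneckerPow t 1)) with hM
  have hM1 : 1 ≤ M := le_max_left _ _
  have hS0 : S ≠ 0 := Literature.Barriers.MatrixMultiplication.kroneckerPow_ne_zero ht k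
  -- `b ≥ 1`: `1 ≤ R(S^{⊠1}) ≤ C(h+2,2) b`
  have hb1 : 1 ≤ b := by
    have h1 : 1 ≤ tensorRank (kroneckerPow S 1) :=
      Literature.Barriers.MatrixMultiplication.one_le_tensorRank_of_ne_zero
        (Literature.Barriers.MatrixMultiplication.kroneckerPow_ne_zero hS0 1)
    have h2 := tensorRank_kroneckerPow_le_of_approxRank_le (t := S) (r := b) (h := h) hh.symm.le 1
    by_contra hb0
    have : b = 0 := by omega
    rw [this, pow_one, mul_zero] at h2
    omega
  have hb0 : (0 : ℝ) < b := by exact_mod_cast hb1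
  have hb1' : (1 : ℝ) ≤ b := by exact_mod_cast hb1
  set ρ : ℝ := (b : ℝ) ^ ((k : ℝ)⁻¹) with hρ
  have hρ1 : 1 ≤ ρ := Real.one_le_rpow hb1' (inv_nonneg.2 (Nat.cast_nonneg _))
  have hρk : ρ ^ k = (b : ℝ) := Real.rpow_inv_natCast_pow hb0.le (by omega)
  refine ⟨(M : ℝ) ^ k * ((h : ℝ) + 2) ^ 2, by positivity, fun N => ?_⟩
  set m := N / k with hm
  have hN := Nat.div_add_mod N k
  -- the integer inequality
  have h1 : tensorRank (kroneckerPow t N) ≤ ((m * h + 2).choose 2 * b ^ m) * M ^ k := by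
    have hadd := tensorRank_kroneckerPow_add_le t (k * m) (N % k)
    rw [hN] at hadd
    refine hadd.trans (Nat.mul_le_mul ?_ ?_)
    · calc tensorRank (kroneckerPow t (k * m)) = tensorRank (kroneckerPow t (m * k)) := by
            rw [mul_comm]
        _ ≤ tensorRank (kroneckerPow S m) := tensorRank_kroneckerPow_mul_le_pow_pow t m k
        _ ≤ (m * h + 2).choose 2 * b ^ m :=
            tensorRank_kroneckerPow_le_of_approxRank_le (t := S) (r := b) (h := h) hh.symm.le m
    · calc tensorRank (kroneckerPow t (N % k)) = tensorRank (kroneckerPow t (1 * (N % k))) := by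
            rw [one_mul]
        _ ≤ tensorRank (kroneckerPow t 1) ^ (N % k) := tensorRank_kroneckerPow_mul_le_pow t 1 _
        _ ≤ M ^ (N % k) := Nat.pow_le_pow_left (le_max_right _ _) _
        _ ≤ M ^ k := Nat.pow_le_pow_right hM1 (Nat.mod_lt N (by omega)).le
  -- the binomial coefficient is quadratic in `m ≤ N`
  have hmN : m ≤ N := Nat.div_le_self N k
  have h2 : ((m * h + 2).choose 2 : ℝ) ≤ ((h : ℝ) + 2) ^ 2 * ((N : ℝ) + 1) ^ 2 := by
    have hc : (m * h + 2).choose 2 ≤ (m * h + 2) ^ 2 := Nat.choose_le_pow _ _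
    have hc' : ((m * h + 2 : ℕ) : ℝ) ≤ ((h : ℝ) + 2) * ((N : ℝ) + 1) := by
      have hmN' : (m : ℝ) ≤ N := by exact_mod_cast hmN
      push_cast
      nlinarith [Nat.cast_nonneg (α := ℝ) m, Nat.cast_nonneg (α := ℝ) h, Nat.cast_nonneg (α := ℝ) N]
    calc ((m * h + 2).choose 2 : ℝ) ≤ (((m * h + 2) ^ 2 : ℕ) : ℝ) := by exact_mod_cast hc
      _ = (((m * h + 2 : ℕ) : ℝ)) ^ 2 := by push_cast; ring
      _ ≤ (((h : ℝ) + 2) * ((N : ℝ) + 1)) ^ 2 := by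
          exact pow_le_pow_left₀ (by positivity) hc' 2
      _ = ((h : ℝ) + 2) ^ 2 * ((N : ℝ) + 1) ^ 2 := by ring
  -- `b^m = ρ^{km} ≤ ρ^N`
  have h3 : (b : ℝ) ^ m ≤ ρ ^ N := by
    rw [← hρk, ← pow_mul]
    exact pow_le_pow_right₀ hρ1 (by rw [hm]; exact Nat.mul_div_le N k)
  calc (tensorRank (kroneckerPow t N) : ℝ)
        ≤ (((m * h + 2).choose 2 * b ^ m * M ^ k : ℕ) : ℝ) := by exact_mod_cast h1
    _ = ((m * h + 2).choose 2 : ℝ) * (b : ℝ) ^ m * (M : ℝ) ^ k := by push_cast; ring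
    _ ≤ (((h : ℝ) + 2) ^ 2 * ((N : ℝ) + 1) ^ 2) * ρ ^ N * (M : ℝ) ^ k := by
        gcongr
    _ = (M : ℝ) ^ k * ((h : ℝ) + 2) ^ 2 * ((N : ℝ) + 1) ^ 2 * ρ ^ N := by ring

/-- **The growth hypothesis of the asymptotic-rank forms from a border-rank bound on one power**:
for a non-zero tensor `t` over `ℂ`, `k ≥ 1` and `b = bR(t^{⊠k}) ≥ 2`, with `ρ = b^{1/k}` (`> 1`),
`R(t^{⊠N}) = O(ρ^{(1+ε)N})` for every `ε > 0` (the polynomial factor of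
`tensorRank_kroneckerPow_le_of_algBorderRank_pow` is `o(ρ^{εN})`; BCS 1997 Lemma (15.27):
"`limsup N⁻¹ log R(φ^{⊠N}) ≤ log bR(φ)`"). [cite: BurgisserClausenShokrollahi1997, Lemma (15.27)] -/
theorem isBigO_tensorRank_kroneckerPow_of_algBorderRank_pow (t : ι → κ → μ → ℂ) (ht : t ≠ 0)
    (k : ℕ) (hk : 1 ≤ k) (hb2 : 2 ≤ algBorderRank (kroneckerPow t k)) (ε : ℝ) (hε : 0 < ε) :
    (fun N : ℕ => (tensorRank (kroneckerPow t N) : ℝ)) =O[atTop]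
      fun N : ℕ => (((algBorderRank (kroneckerPow t k) : ℕ) : ℝ) ^ ((k : ℝ)⁻¹)) ^ ((1 + ε) * N) := by
  obtain ⟨C, hC, hCN⟩ := tensorRank_kroneckerPow_le_of_algBorderRank_pow t ht k hk
  set b : ℕ := algBorderRank (kroneckerPow t k) with hb
  have hb1 : (1 : ℝ) < b := by exact_mod_cast hb2
  have hb0 : (0 : ℝ) < b := by linarith
  set ρ : ℝ := (b : ℝ) ^ ((k : ℝ)⁻¹) with hρ
  have hk0 : (0 : ℝ) < (k : ℝ)⁻¹ := inv_pos.2 (by exact_mod_cast hk)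
  have hρ1 : 1 < ρ := Real.one_lt_rpow hb1 hk0
  have hρ0 : 0 < ρ := by linarith
  -- `ρ^ε > 1`, so `(N+1)² = o((ρ^ε)^N)`
  set r : ℝ := ρ ^ ε with hr
  have hr1 : 1 < r := Real.one_lt_rpow hρ1 hε
  have hr0 : 0 < r := by linarith
  have hpoly : (fun N : ℕ => ((N : ℝ) + 1) ^ 2) =o[atTop] fun N : ℕ => r ^ N := by
    have h1 : (fun N : ℕ => ((N : ℝ) + 1) ^ 2) =O[atTop] fun N : ℕ => ((N : ℝ)) ^ 2 := by
      refine IsBigO.of_bound 4 ?_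
      filter_upwards [Filter.eventually_ge_atTop 1] with N hN
      have hN' : (1 : ℝ) ≤ N := by exact_mod_cast hN
      rw [Real.norm_of_nonneg (by positivity), Real.norm_of_nonneg (by positivity)]
      nlinarith
    exact h1.trans_isLittleO (isLittleO_pow_const_const_pow_of_one_lt 2 hr1)
  -- assemble: `R(t^{⊠N}) ≤ C (N+1)² ρ^N` and `(N+1)² ρ^N = o(r^N ρ^N) = o(ρ^{(1+ε)N})`
  have hmain : (fun N : ℕ => (tensorRank (kroneckerPow t N) : ℝ)) =O[atTop]
      fun N : ℕ => ((N : ℝ) + 1) ^ 2 * ρ ^ N := by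
    refine IsBigO.of_bound C (Filter.Eventually.of_forall fun N => ?_)
    rw [Real.norm_of_nonneg (Nat.cast_nonneg _), Real.norm_of_nonneg (by positivity)]
    calc (tensorRank (kroneckerPow t N) : ℝ) ≤ C * ((N : ℝ) + 1) ^ 2 * ρ ^ N := hCN N
      _ = C * (((N : ℝ) + 1) ^ 2 * ρ ^ N) := by ring
  have hstep : (fun N : ℕ => ((N : ℝ) + 1) ^ 2 * ρ ^ N) =O[atTop]
      fun N : ℕ => r ^ N * ρ ^ N :=
    hpoly.isBigO.mul (isBigO_refl _ _)
  have heq : ∀ N : ℕ, r ^ N * ρ ^ N = ρ ^ ((1 + ε) * N) := by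
    intro N
    rw [hr, ← Real.rpow_natCast (ρ ^ ε) N, ← Real.rpow_mul hρ0.le, ← Real.rpow_natCast ρ N,
      ← Real.rpow_add hρ0]
    congr 1
    ring
  have hstep' : (fun N : ℕ => ((N : ℝ) + 1) ^ 2 * ρ ^ N) =O[atTop]
      fun N : ℕ => ρ ^ ((1 + ε) * N) :=
    hstep.trans (isBigO_of_le _ fun N => by rw [heq N])
  exact hmain.trans hstep'

/-- A Kronecker product `t ⊠ s` restricts to `t` as soon as `s` has an entry equal to `1`
(fix those coordinates of the second factor). [folklore] -/
private theorem tensorRestrictsTo_kroneckerTensor_left_of_entry_eq_one {ι' κ' μ' : Type} [Fintype ι']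
    [Fintype κ'] [Fintype μ'] [DecidableEq ι'] [DecidableEq κ'] [DecidableEq μ']
    (t : ι → κ → μ → ℂ) (s : ι' → κ' → μ' → ℂ) (a₀ : ι') (b₀ : κ') (c₀ : μ')
    (hs : s a₀ b₀ c₀ = 1) : TensorRestrictsTo (kroneckerTensor t s) t := by
  classical
  refine ⟨fun a p => if p = (a, a₀) then 1 else 0, fun b p => if p = (b, b₀) then 1 else 0,
    fun c p => if p = (c, c₀) then 1 else 0, fun a b c => ?_⟩
  rw [Finset.sum_eq_single (a, a₀) (fun p _ hp => by simp [hp]) (by simp),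
    Finset.sum_eq_single (b, b₀) (fun p _ hp => by simp [hp]) (by simp),
    Finset.sum_eq_single (c, c₀) (fun p _ hp => by simp [hp]) (by simp)]
  simp [kroneckerTensor_apply, hs]

/-- **`bR(t) ≤ bR(t^{⊠k})` for `k ≥ 1`** when some entry of `t` equals `1`: `t^{⊠k} ≅ t ⊠ t^{⊠(k-1)}`
(`algBorderRank_kroneckerPow_succ`) restricts to `t` (the entry `1` of `t` gives the entry `1` of
`t^{⊠(k-1)}` at the constant indices), and "border rank is upper semi-continuous under
degeneration: if `T'` is a degeneration of `T`, then `bR(T') ≤ bR(T)`" (CGLV §1.1, p. 3; a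
restriction is a degeneration; tree `TensorRestrictsTo.algBorderRank_le`) — the instance
`T' = t`, `T = t^{⊠k}`. [cite: ConnerGesmundoLandsbergVentura2022, §1.1 (p. 3: border rank under degeneration), instance T ≤ T^{⊠k}] -/
theorem algBorderRank_le_algBorderRank_kroneckerPow (t : ι → κ → μ → ℂ) (a₀ : ι) (b₀ : κ) (c₀ : μ)
    (ht : t a₀ b₀ c₀ = 1) (k : ℕ) (hk : 1 ≤ k) :
    algBorderRank t ≤ algBorderRank (kroneckerPow t k) := by
  obtain ⟨k', rfl⟩ : ∃ k', k = k' + 1 := ⟨k - 1, by omega⟩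
  rw [algBorderRank_kroneckerPow_succ]
  refine TensorRestrictsTo.algBorderRank_le
    (tensorRestrictsTo_kroneckerTensor_left_of_entry_eq_one t (kroneckerPow t k')
      (fun _ => a₀) (fun _ => b₀) (fun _ => c₀) ?_)
  simp [kroneckerPow_apply, ht]

end Growth

/-! ## The discharge: CGLV 2022, Thm. 2.5 verbatim -/

section SkewBorderRank

/-- `T_{skewcw,q}(0, q, q) = 1`. [cite: ConnerGesmundoLandsbergVentura2022, eq. (3)] -/
theorem skewCwTensor_zero_last_last (u : ℕ) (hu : 1 ≤ u) :
    skewCwTensor ℂ u 0 (Fin.last (2 * u)) (Fin.last (2 * u)) = 1 := by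
  have hj : (Fin.last (2 * u) : Fin (2 * u + 1)) ≠ 0 := by
    intro h'
    have := congrArg Fin.val h'
    simp only [Fin.val_last, Fin.val_zero] at this
    omega
  simp [skewCwTensor, hj]

/-- **`bR(T_{skewcw,q}^{⊠k}) ≥ q + 3 ≥ 5`** over `ℂ` for `q = 2u ≥ 2`, `k ≥ 1` (CGLV Prop. 3.1's
lower bound `bR(T_{skewcw,q}) ≥ q + 3`, tree `add_three_le_algBorderRank_skewCwTensor`, transported
to the powers by `algBorderRank_le_algBorderRank_kroneckerPow`).
[cite: ConnerGesmundoLandsbergVentura2022, Prop. 3.1] -/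
theorem add_three_le_algBorderRank_kroneckerPow_skewCwTensor (u k : ℕ) (hu : 1 ≤ u) (hk : 1 ≤ k) :
    2 * u + 3 ≤ algBorderRank (kroneckerPow (skewCwTensor ℂ u) k) :=
  (add_three_le_algBorderRank_skewCwTensor (K := ℂ) two_ne_zero (by omega)).trans
    (algBorderRank_le_algBorderRank_kroneckerPow _ _ _ _ (skewCwTensor_zero_last_last u hu) k hk)

/-- **CGLV 2022 §2.2 (arXiv Thm. 2.5), border-rank form — DISCHARGE of the named fact
`CGLV2022_skewCw_borderRank_form`**: for every even `q = 2u ≥ 2` and every `k ≥ 1`,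
`ω(ℂ) ≤ log_q((4/27) · bR(T_{skewcw,q}^{⊠k})^{3/k})`.  Proof: with `b = bR(T^{⊠k}) ≥ 5` and
`ρ = b^{1/k} > 1`, `R(T^{⊠N}) = O(ρ^{(1+ε)N})` for every `ε > 0`
(`isBigO_tensorRank_kroneckerPow_of_algBorderRank_pow`), which is the hypothesis of the PROVED
asymptotic-rank form `CGLV2022_skewCw_asymptoticRank_form_holds`; its conclusion
`ω ≤ log_q(4ρ³/27)` is the claim since `ρ³ = b^{3/k}`.
[cite: ConnerGesmundoLandsbergVentura2022, §2.2 Thm. 2.5 (arXiv:1909.04785 numbering)] -/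
theorem CGLV2022_skewCw_borderRank_form_holds : CGLV2022_skewCw_borderRank_form := by
  intro u k hu hk
  set T := skewCwTensor ℂ u with hT
  have hT0 : T ≠ 0 := skewCwTensor_ne_zero ℂ u hu
  set b : ℕ := algBorderRank (kroneckerPow T k) with hb
  have hb2 : 2 ≤ b :=
    le_trans (by omega) (add_three_le_algBorderRank_kroneckerPow_skewCwTensor u k hu hk)
  have hb0 : (0 : ℝ) < b := by exact_mod_cast (show 0 < b by omega)
  set ρ : ℝ := (b : ℝ) ^ ((k : ℝ)⁻¹) with hρ
  have hb1 : (1 : ℝ) < b := by exact_mod_cast hb2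
  have hρ1 : 1 < ρ := Real.one_lt_rpow hb1 (inv_pos.2 (by exact_mod_cast hk))
  have hρ0 : 0 < ρ := by linarith
  have hyp : ∀ ε : ℝ, 0 < ε →
      (fun N : ℕ => (tensorRank (kroneckerPow T N) : ℝ)) =O[atTop]
        fun N : ℕ => ρ ^ ((1 + ε) * N) :=
    fun ε hε => isBigO_tensorRank_kroneckerPow_of_algBorderRank_pow T hT0 k hk hb2 ε hε
  have h := CGLV2022_skewCw_asymptoticRank_form_holds u hu ρ hρ0 hyp
  have hρ3 : ρ ^ 3 = (b : ℝ) ^ ((3 : ℝ) / k) := by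
    rw [hρ, ← Real.rpow_natCast, ← Real.rpow_mul hb0.le]
    congr 1
    push_cast
    ring
  have e : 4 * ρ ^ 3 / 27 = 4 / 27 * (b : ℝ) ^ ((3 : ℝ) / k) := by rw [hρ3]; ring
  rwa [e] at h

/-- The three shapes of CGLV Thm. 2.5 now all hold unconditionally; in particular
**`bR(T_{skewcw,2}^{⊠k}) ≤ 3^k` for some `k ≥ 1` would give `ω = 2`** (the border-rank version of
"`R̃(T_{skewcw,2}) = 3` would imply `ω = 2`", CGLV p. 5): with `u = 1`,
`ω ≤ log₂((4/27)·(3^k)^{3/k}) = log₂ 4 = 2`. [cite: ConnerGesmundoLandsbergVentura2022, §2.2 (remark before Lemma 2.4)] -/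
theorem omega_le_two_of_algBorderRank_kroneckerPow_skewCw_one (k : ℕ) (hk : 1 ≤ k)
    (hb : algBorderRank (kroneckerPow (skewCwTensor ℂ 1) k) ≤ 3 ^ k) : omega ℂ ≤ 2 := by
  have h := CGLV2022_skewCw_borderRank_form_holds 1 k le_rfl hk
  have hk0 : (0 : ℝ) < k := by exact_mod_cast hk
  have hb' : ((algBorderRank (kroneckerPow (skewCwTensor ℂ 1) k) : ℕ) : ℝ) ≤ (3 : ℝ) ^ (k : ℝ) := by
    rw [Real.rpow_natCast]; exact_mod_cast hb
  have h5 := add_three_le_algBorderRank_kroneckerPow_skewCwTensor 1 k le_rfl hk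
  have hbpos : (0 : ℝ) < ((algBorderRank (kroneckerPow (skewCwTensor ℂ 1) k) : ℕ) : ℝ) := by
    exact_mod_cast (show 0 < algBorderRank (kroneckerPow (skewCwTensor ℂ 1) k) by omega)
  have hpow : (((algBorderRank (kroneckerPow (skewCwTensor ℂ 1) k) : ℕ) : ℝ)) ^ ((3 : ℝ) / k)
      ≤ 27 := by
    calc (((algBorderRank (kroneckerPow (skewCwTensor ℂ 1) k) : ℕ) : ℝ)) ^ ((3 : ℝ) / k)
          ≤ ((3 : ℝ) ^ (k : ℝ)) ^ ((3 : ℝ) / k) :=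
            Real.rpow_le_rpow hbpos.le hb' (by positivity)
      _ = 27 := by
          rw [← Real.rpow_mul (by norm_num : (0 : ℝ) ≤ 3)]
          rw [show (k : ℝ) * (3 / k) = 3 by field_simp]
          norm_num
  have harg : (4 : ℝ) / 27 * (((algBorderRank (kroneckerPow (skewCwTensor ℂ 1) k) : ℕ) : ℝ)) ^
      ((3 : ℝ) / k) ≤ 4 := by nlinarith
  have hargpos : (0 : ℝ) < (4 : ℝ) / 27 *
      (((algBorderRank (kroneckerPow (skewCwTensor ℂ 1) k) : ℕ) : ℝ)) ^ ((3 : ℝ) / k) := by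
    positivity
  have hq : ((2 : ℝ) * ((1 : ℕ) : ℝ)) = 2 := by norm_num
  rw [hq] at h
  calc omega ℂ ≤ Real.logb 2 ((4 : ℝ) / 27 *
        (((algBorderRank (kroneckerPow (skewCwTensor ℂ 1) k) : ℕ) : ℝ)) ^ ((3 : ℝ) / k)) := h
    _ ≤ Real.logb 2 4 := Real.logb_le_logb_of_le (by norm_num) hargpos harg
    _ = 2 := by
        rw [show (4 : ℝ) = 2 ^ (2 : ℕ) by norm_num, Real.logb_pow, Real.logb_self_eq_one (by norm_num)]
        norm_num

end SkewBorderRank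

/-! ## The same composition for `T_{cw,q}`: CGLV Thm. 1.1 verbatim -/

section CwBorderRank

/-- `T_{cw,q}(0, q, q) = 1` for `q ≥ 1`. [cite: ConnerGesmundoLandsbergVentura2022, §1 (definition of T_cw,q)] -/
theorem cwTensor_zero_last_last (q : ℕ) (hq : 1 ≤ q) :
    cwTensor ℂ q 0 (Fin.last q) (Fin.last q) = 1 := by
  have hj : (Fin.last q : Fin (q + 1)) ≠ 0 := by
    intro h'
    have := congrArg Fin.val h'
    simp only [Fin.val_last, Fin.val_zero] at this
    omega
  exact cwTensor_zero_left ℂ q hj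

/-- **`bR(T_{cw,q}^{⊠k}) ≥ q + 2 ≥ 3`** for `q, k ≥ 1` (the tree's `bR(T_{cw,q}) = q + 2`, direction
`≥` = `le_algBorderRank_cwTensor`, transported to the powers by restriction), `q ≥ 2`.
[cite: ConnerGesmundoLandsbergVentura2022, §1.2 (bR(T_cw,q) = q+2)] -/
theorem add_two_le_algBorderRank_kroneckerPow_cwTensor (q k : ℕ) (hq : 2 ≤ q) (hk : 1 ≤ k) :
    q + 2 ≤ algBorderRank (kroneckerPow (cwTensor ℂ q) k) :=
  (le_algBorderRank_cwTensor ℂ hq).trans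
    (algBorderRank_le_algBorderRank_kroneckerPow _ _ _ _ (cwTensor_zero_last_last q (by omega)) k hk)

/-- **CGLV 2022, Thm. 1.1 (= Coppersmith–Winograd 1990 §6 / BCS 1997 Ex. 15.24(7)), border-rank form,
verbatim: for all `q ≥ 2` and `k ≥ 1`, `ω(ℂ) ≤ log_q((4/27) · bR(T_{cw,q}^{⊠k})^{3/k})`.**  Proved by
the same composition as `CGLV2022_skewCw_borderRank_form_holds`, from the tree's
`CoppersmithWinograd1990_asymptoticRank_form_holds` (whose inline Kronecker power of `T_{cw,q}` is
definitionally `kroneckerPow (cwTensor ℂ q)`). [cite: ConnerGesmundoLandsbergVentura2022, Thm. 1.1] -/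
theorem CGLV2022_thm11_cw_borderRank_form (q k : ℕ) (hq : 2 ≤ q) (hk : 1 ≤ k) :
    omega ℂ ≤ Real.logb q ((4 / 27) *
      ((algBorderRank (kroneckerPow (cwTensor ℂ q) k) : ℝ) ^ ((3 : ℝ) / k))) := by
  set T := cwTensor ℂ q with hT
  have hq1 : 1 ≤ q := by omega
  have hT0 : T ≠ 0 := by
    intro h0
    have h1 := cwTensor_zero_last_last q hq1
    rw [← hT, h0] at h1
    exact zero_ne_one h1
  set b : ℕ := algBorderRank (kroneckerPow T k) with hb
  have hb2 : 2 ≤ b := le_trans (by omega) (add_two_le_algBorderRank_kroneckerPow_cwTensor q k hq hk)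
  have hb0 : (0 : ℝ) < b := by exact_mod_cast (show 0 < b by omega)
  set ρ : ℝ := (b : ℝ) ^ ((k : ℝ)⁻¹) with hρ
  have hb1 : (1 : ℝ) < b := by exact_mod_cast hb2
  have hρ1 : 1 < ρ := Real.one_lt_rpow hb1 (inv_pos.2 (by exact_mod_cast hk))
  have hρ0 : 0 < ρ := by linarith
  have hyp : ∀ ε : ℝ, 0 < ε →
      (fun N : ℕ => (tensorRank (kroneckerPow T N) : ℝ)) =O[atTop]
        fun N : ℕ => ρ ^ ((1 + ε) * N) :=
    fun ε hε => isBigO_tensorRank_kroneckerPow_of_algBorderRank_pow T hT0 k hk hb2 ε hε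
  have h := CoppersmithWinograd1990_asymptoticRank_form_holds q hq ρ hρ0 hyp
  have hρ3 : ρ ^ 3 = (b : ℝ) ^ ((3 : ℝ) / k) := by
    rw [hρ, ← Real.rpow_natCast, ← Real.rpow_mul hb0.le]
    congr 1
    push_cast
    ring
  have e : 4 * ρ ^ 3 / 27 = 4 / 27 * (b : ℝ) ^ ((3 : ℝ) / k) := by rw [hρ3]; ring
  rwa [e] at h

end CwBorderRank

end Literature.Computability.AlgebraicComplexity

end
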